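import Literature.NumberTheory.LFunctions.DirichletExplicitRegionRealZeros
import HarnessLib

/-!
# McCurley's Lemma 3, sharpened: the zeta term `f_ζ(σ) = Re(−ζ'/ζ(σ)) − κ Re(−ζ'/ζ(σ₁))` at real points

Topic `Literature/NumberTheory/LFunctions` (namespace `Literature.NumberTheory.LFunctions.McCurleyStechkin`),
continuing `ExplicitLandauRepulsionStechkin.lean` (whose `zetaTerm_le` gives `f_ζ(σ) ≤ 1/(σ−1) − 0.325`)
and `DirichletExplicitRegionRealZeros.lean` (`fdiff_principal_eq`). Everything here is PROVED (standard
axioms); no definitions, NO named fact.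

Source: K. S. McCurley, *Explicit zero-free regions for Dirichlet L-functions*, J. Number Theory **19**
(1984) 7–32 [McCurley1984ZFR], **Lemma 3** (p. 14): "Let `χ₀` be the principal character modulo `k`.
If `1 < σ ≤ 1.15`, then `f(0, χ₀) ≤ 1/(σ−1) − 0.8973 − s(k)`. If `1 < σ ≤ 1.3`, then
`f(0, χ₀) ≤ 1/(σ−1) − 0.7833`." Proof as printed: (11) `f(0,χ₀) = −ζ'/ζ(σ) + κ ζ'/ζ(σ₁) − s(k)`;
(12) `κ ζ'/ζ(σ₁) < −0.3783` (`σ ≤ 1.15`), `< −0.2993` (`σ ≤ 1.3`) "from the terms with `p < 250`" of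
`−ζ'/ζ(σ₁) = Σ Λ(n) n^{−σ₁}`; and `−ζ'/ζ(σ) < 1/(σ−1) − ½ log π + ½ ψ(σ/2 + 1)` (Davenport, the zero
sum being non-negative), with `ψ` bounded through its concavity.

This file proves the same with slightly weaker constants (prime powers `n ≤ 16` instead of `p < 250`,
the tangent of `ψ` at `2` instead of tables):

* `re_digamma_le_tangent_two`: `ψ(x) ≤ 1 − γ + (x − 2)(π²/6 − 1)` for `x > 0` (concavity, termwise in
  Gauss's series; `ψ(2) = 1 − γ`, `ψ'(2) = π²/6 − 1`); hence `ψ(x) ≤ 0.19706` (`x ≤ 1.65`),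
  `ψ(x) ≤ 0.14869` (`x ≤ 1.575`).
* `neg_logDeriv_zeta_re_le_13/115`: `−ζ'/ζ(σ) ≤ 1/(σ−1) − 0.4737` (`1 < σ ≤ 1.3`),
  `≤ 1/(σ−1) − 0.4979` (`1 < σ ≤ 1.15`) [McCurley: `0.484`, `0.519`].
* `sum_vonMangoldt_div_rpow_le`, `vonMangoldt_div_rpow_ge`: `Σ_{n∈S} Λ(n)n^{−s} ≤ −ζ'/ζ(s)` and
  `Λ(n) n^{−s} ≥ Λ(n) n^{−2}(1 + y + y²/2)`, `y = (2−s)·log n` (`e^y ≥ 1 + y + y²/2`);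
  `neg_logDeriv_zeta_re_ge_19/176`: `−ζ'/ζ(s) ≥ 0.5738` (`1 < s ≤ 1.9`), `≥ 0.6869` (`1 < s ≤ 1.76`).
* `fdiffZeta_le_sharp13/115`: **`f_ζ(σ) ≤ 1/(σ−1) − 0.73`** (`1 < σ ≤ 1.3`), **`≤ 1/(σ−1) − 0.80`**
  (`1 < σ ≤ 1.15`) [McCurley: `0.7833`, `0.8973`]; `fdiff_principal_le_sharp13/115`: the same for
  `f(0, χ₀ mod k)` with McCurley's `−s(k)` kept exactly (`fdiff_principal_eq`).

## References

* K. S. McCurley, J. Number Theory 19 (1984) 7–32, doi:10.1016/0022-314x(84)90089-1: Lemma 3, (11)–(12)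
  (p. 14). [McCurley1984ZFR]
* H. Davenport, *Multiplicative Number Theory*, Ch. 12 (the formula for `−ζ'/ζ`). [DavenportMNT1980]
* G. E. Andrews, R. Askey, R. Roy, *Special Functions*, Thm 1.2.5 (Gauss's series for `ψ`). [AndrewsAskeyRoy1999]
-/

noncomputable section

open Real Complex

namespace Literature.NumberTheory.LFunctions

namespace McCurleyStechkin

open Literature.Analysis.SpecialFunctions ArithmeticFunction

/-! ## The tangent bound for `ψ` at `2` -/

/-- `ψ(2) = 1 − γ`. [cite: AndrewsAskeyRoy1999, Thm 1.2.5] -/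
theorem re_digamma_two : (Complex.digamma ((2 : ℝ) : ℂ)).re = 1 - Real.eulerMascheroniConstant := by
  have h := Literature.Analysis.SpecialFunctions.re_digamma_add_one one_pos
  rw [Complex.ofReal_one, Complex.digamma_one] at h
  have h' : (Complex.digamma ((1 : ℂ) + 1)).re = -Real.eulerMascheroniConstant + 1 := by
    rw [h]; simp
  rw [show ((2 : ℝ) : ℂ) = (1 : ℂ) + 1 by push_cast; norm_num, h']
  ring

/-- Gauss's series at `2`: `Σₖ [1/(k+1) − 1/(2+k)] = 1`. [cite: AndrewsAskeyRoy1999, Thm 1.2.5 (1.2.13)] -/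
theorem hasSum_gauss_two : HasSum (fun k : ℕ ↦ 1 / ((k : ℝ) + 1) - 1 / (2 + k)) 1 := by
  have h := hasSum_re_digamma (x := (2 : ℝ)) two_pos
  rwa [re_digamma_two, sub_add_cancel] at h

/-- `Σₖ 1/(k+2)² = π²/6 − 1`. [folklore] -/
private theorem hasSum_inv_sq_shift_two : HasSum (fun k : ℕ ↦ 1 / ((k : ℝ) + 2) ^ 2) (π ^ 2 / 6 - 1) := by
  have h := (hasSum_nat_add_iff' 1).2 hasSum_one_div_nat_add_one_sq
  simp only [Finset.sum_range_one, Nat.cast_zero, zero_add, one_pow, div_one, Nat.cast_add,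
    Nat.cast_one] at h
  refine h.congr_fun fun k ↦ ?_
  ring

/-- **The tangent of `ψ` at `2` lies above `ψ`** (concavity): `ψ(x) ≤ 1 − γ + (x − 2)(π²/6 − 1)` for
every `x > 0` (termwise in Gauss's series: `−1/(x+k) ≤ −1/(k+2) + (x−2)/(k+2)²`).
[cite: McCurley1984ZFR, Lemma 3 (proof: "The graph of the function Γ'/Γ(z) is concave down for z > 0")] -/
theorem re_digamma_le_tangent_two {x : ℝ} (hx : 0 < x) :
    (Complex.digamma x).re ≤ 1 - Real.eulerMascheroniConstant + (x - 2) * (π ^ 2 / 6 - 1) := by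
  have h1 := hasSum_re_digamma hx
  have h2 := hasSum_gauss_two.add (hasSum_inv_sq_shift_two.mul_left (x - 2))
  have h := hasSum_le (fun k ↦ ?_) h1 h2
  · linarith
  · have hk2 : (0 : ℝ) < (k : ℝ) + 2 := by positivity
    have hxk : 0 < x + k := by positivity
    have e : 1 / ((k : ℝ) + 1) - 1 / (x + k)
        - (1 / ((k : ℝ) + 1) - 1 / (2 + k) + (x - 2) * (1 / ((k : ℝ) + 2) ^ 2)) =
        -((x - 2) ^ 2) / ((x + k) * ((k : ℝ) + 2) ^ 2) := by
      field_simp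
      ring
    have hle : -((x - 2) ^ 2) / ((x + k) * ((k : ℝ) + 2) ^ 2) ≤ 0 :=
      div_nonpos_of_nonpos_of_nonneg (by nlinarith [sq_nonneg (x - 2)]) (by positivity)
    linarith

/-- `ψ(x) ≤ 0.19706` for `0 < x ≤ 1.65`. [cite: McCurley1984ZFR, Lemma 3 (proof)] -/
theorem re_digamma_le_at_165' {x : ℝ} (hx : 0 < x) (hx' : x ≤ 1.65) :
    (Complex.digamma x).re ≤ 0.19706 := by
  have h1 := re_digamma_mono hx hx'
  have h2 := re_digamma_le_tangent_two (x := (1.65 : ℝ)) (by norm_num)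
  have hγ := Literature.Analysis.SpecialFunctions.Real.eulerMascheroniConstant_gt_d8
  have hπ := Real.pi_gt_d6
  have : (3.141592 : ℝ) ^ 2 ≤ π ^ 2 := pow_le_pow_left₀ (by norm_num) hπ.le 2
  nlinarith

/-- `ψ(x) ≤ 0.14869` for `0 < x ≤ 1.575`. [cite: McCurley1984ZFR, Lemma 3 (proof)] -/
theorem re_digamma_le_at_1575 {x : ℝ} (hx : 0 < x) (hx' : x ≤ 1.575) :
    (Complex.digamma x).re ≤ 0.14869 := by
  have h1 := re_digamma_mono hx hx'
  have h2 := re_digamma_le_tangent_two (x := (1.575 : ℝ)) (by norm_num)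
  have hγ := Literature.Analysis.SpecialFunctions.Real.eulerMascheroniConstant_gt_d8
  have hπ := Real.pi_gt_d6
  have : (3.141592 : ℝ) ^ 2 ≤ π ^ 2 := pow_le_pow_left₀ (by norm_num) hπ.le 2
  nlinarith

/-! ## `−ζ'/ζ(σ)` from above -/

/-- `1.1447 ≤ log π`. [folklore] -/
private theorem log_pi_ge' : (1.1447 : ℝ) ≤ Real.log π := by
  rw [Real.le_log_iff_exp_le Real.pi_pos]
  have h1 : Real.exp 1.1447 = Real.exp 1 * Real.exp 0.1447 := by rw [← Real.exp_add]; norm_num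
  have h2 : Real.exp 0.1447 ≤ 1.1556934 := by
    have h := Real.exp_bound' (x := (0.1447 : ℝ)) (by norm_num) (by norm_num) (n := 5) (by norm_num)
    refine h.trans ?_
    simp only [Finset.sum_range_succ, Finset.sum_range_zero, Nat.factorial]
    norm_num
  rw [h1]
  have := Real.exp_one_lt_d9
  have := Real.pi_gt_d6
  nlinarith [Real.exp_pos 0.1447]

/-- **`−ζ'/ζ(σ) ≤ 1/(σ−1) − 0.4737` for `1 < σ ≤ 1.3`** (de la Vallée Poussin's formula with the zero
sum dropped, `½ψ(σ/2+1) ≤ ½ψ(1.65)`). [cite: McCurley1984ZFR, Lemma 3 (proof)] -/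
theorem neg_logDeriv_zeta_re_le_13 {σ : ℝ} (hσ : 1 < σ) (hσ' : σ ≤ 1.3) :
    (-(deriv riemannZeta σ / riemannZeta σ)).re ≤ 1 / (σ - 1) - 0.4737 := by
  have h1 := neg_logDeriv_riemannZeta_re_le hσ
  have e : (σ : ℂ) / 2 + 1 = ((σ / 2 + 1 : ℝ) : ℂ) := by push_cast; ring
  rw [e] at h1
  have h3 := re_digamma_le_at_165' (x := σ / 2 + 1) (by linarith) (by linarith)
  have hlp := log_pi_ge'
  linarith

/-- **`−ζ'/ζ(σ) ≤ 1/(σ−1) − 0.4979` for `1 < σ ≤ 1.15`.** [cite: McCurley1984ZFR, Lemma 3 (proof)] -/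
theorem neg_logDeriv_zeta_re_le_115 {σ : ℝ} (hσ : 1 < σ) (hσ' : σ ≤ 1.15) :
    (-(deriv riemannZeta σ / riemannZeta σ)).re ≤ 1 / (σ - 1) - 0.4979 := by
  have h1 := neg_logDeriv_riemannZeta_re_le hσ
  have e : (σ : ℂ) / 2 + 1 = ((σ / 2 + 1 : ℝ) : ℂ) := by push_cast; ring
  rw [e] at h1
  have h3 := re_digamma_le_at_1575 (x := σ / 2 + 1) (by linarith) (by linarith)
  have hlp := log_pi_ge'
  linarith

/-! ## `−ζ'/ζ(s)` from below: prime powers `n ≤ 16` -/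

/-- **Partial sums of `Σ Λ(n) n^{−s}` are below `−ζ'/ζ(s)`** (real `s > 1`; non-negative terms).
[cite: McCurley1984ZFR, Lemma 3 (proof, (12): "From the terms with p < 250 we get …")] -/
theorem sum_vonMangoldt_div_rpow_le {s : ℝ} (hs : 1 < s) (S : Finset ℕ) :
    ∑ n ∈ S, (Λ n : ℝ) / (n : ℝ) ^ s ≤ (-(deriv riemannZeta s / riemannZeta s)).re :=
  sum_le_hasSum S (fun n _ ↦ div_nonneg vonMangoldt_nonneg (by positivity)) (hasSum_vonMangoldt_zeta hs)

/-- **One term from below**: for `n ≥ 1`, `s ≤ 2 − c`, `c ≥ 0` and `0 ≤ L ≤ log n`: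
`Λ(n) n^{−s} ≥ Λ(n) n^{−2} (1 + cL + (cL)²/2)` (`n^{2−s} ≥ n^c = e^{c log n} ≥ 1 + y + y²/2`).
[cite: McCurley1984ZFR, Lemma 3 (proof, (12))] -/
theorem vonMangoldt_div_rpow_ge {n : ℕ} (hn : 1 ≤ n) {s c : ℝ} (hs : s ≤ 2 - c) (hc : 0 ≤ c) {L : ℝ}
    (hL0 : 0 ≤ L) (hL : L ≤ Real.log n) :
    (Λ n : ℝ) / (n : ℝ) ^ 2 * (1 + c * L + (c * L) ^ 2 / 2) ≤ (Λ n : ℝ) / (n : ℝ) ^ s := by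
  have hn1 : (1 : ℝ) ≤ n := by exact_mod_cast hn
  have hn0 : (0 : ℝ) < n := by linarith
  have hΛ : 0 ≤ (Λ n : ℝ) := vonMangoldt_nonneg
  -- `n^s ≤ n^{2−c} = n² / n^c`
  have h1 : (n : ℝ) ^ s ≤ (n : ℝ) ^ (2 - c) := Real.rpow_le_rpow_of_exponent_le hn1 hs
  have h2 : (n : ℝ) ^ (2 - c) = (n : ℝ) ^ 2 / (n : ℝ) ^ c := by
    rw [Real.rpow_sub hn0, Real.rpow_two]
  -- `n^c ≥ 1 + cL + (cL)²/2`
  have h3 : 1 + c * L + (c * L) ^ 2 / 2 ≤ (n : ℝ) ^ c := by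
    rw [Real.rpow_def_of_pos hn0]
    have hy : 0 ≤ c * L := mul_nonneg hc hL0
    have hexp : 1 + c * L + (c * L) ^ 2 / 2 ≤ Real.exp (c * L) := by
      have h := Real.sum_le_exp_of_nonneg hy 3
      simp only [Finset.sum_range_succ, Finset.sum_range_zero, Nat.factorial] at h
      norm_num at h
      linarith
    refine hexp.trans (Real.exp_le_exp.2 ?_)
    rw [mul_comm]
    exact mul_le_mul_of_nonneg_right hL hc
  have hpc : 0 < (n : ℝ) ^ c := Real.rpow_pos_of_pos hn0 _
  have hps : 0 < (n : ℝ) ^ s := Real.rpow_pos_of_pos hn0 _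
  have hpoly : 0 < 1 + c * L + (c * L) ^ 2 / 2 := by nlinarith [mul_nonneg hc hL0, sq_nonneg (c * L)]
  -- assemble: `Λ/n^s ≥ Λ/n^{2-c} = Λ n^c/n² ≥ Λ (1+…)/n²`
  calc (Λ n : ℝ) / (n : ℝ) ^ 2 * (1 + c * L + (c * L) ^ 2 / 2)
      ≤ (Λ n : ℝ) / (n : ℝ) ^ 2 * (n : ℝ) ^ c := mul_le_mul_of_nonneg_left h3 (by positivity)
    _ = (Λ n : ℝ) / ((n : ℝ) ^ 2 / (n : ℝ) ^ c) := by field_simp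
    _ = (Λ n : ℝ) / (n : ℝ) ^ (2 - c) := by rw [h2]
    _ ≤ (Λ n : ℝ) / (n : ℝ) ^ s := div_le_div_of_nonneg_left hΛ hps h1

/-! ### Logarithms of small primes from below -/

/-- `0.693147 ≤ log 2`. [folklore] -/
private theorem log_two_ge : (0.693147 : ℝ) ≤ Real.log 2 := by linarith [Real.log_two_gt_d9]

/-- `1.098612 ≤ log 3`. [folklore] -/
private theorem log_three_ge : (1.098612 : ℝ) ≤ Real.log 3 := by
  rw [Real.le_log_iff_exp_le (by norm_num)]
  have h1 : Real.exp 1.098612 = Real.exp 1 * Real.exp 0.098612 := by rw [← Real.exp_add]; norm_num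
  have h2 : Real.exp 0.098612 ≤ 1.1036381 := by
    have h := Real.exp_bound' (x := (0.098612 : ℝ)) (by norm_num) (by norm_num) (n := 5) (by norm_num)
    refine h.trans ?_
    simp only [Finset.sum_range_succ, Finset.sum_range_zero, Nat.factorial]
    norm_num
  rw [h1]
  have := Real.exp_one_lt_d9
  nlinarith [Real.exp_pos 0.098612]

/-- `1.609437 ≤ log 5`. [folklore] -/
private theorem log_five_ge : (1.609437 : ℝ) ≤ Real.log 5 := by
  rw [Real.le_log_iff_exp_le (by norm_num)]
  have h1 : Real.exp 1.609437 = Real.exp 1 * Real.exp 0.609437 := by rw [← Real.exp_add]; norm_num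
  have h2 : Real.exp 0.609437 ≤ 1.839396 := by
    have h := Real.exp_bound' (x := (0.609437 : ℝ)) (by norm_num) (by norm_num) (n := 7) (by norm_num)
    refine h.trans ?_
    simp only [Finset.sum_range_succ, Finset.sum_range_zero, Nat.factorial]
    norm_num
  rw [h1]
  have := Real.exp_one_lt_d9
  nlinarith [Real.exp_pos 0.609437]

/-- `1.945910 ≤ log 7`. [folklore] -/
private theorem log_seven_ge : (1.945910 : ℝ) ≤ Real.log 7 := by
  rw [Real.le_log_iff_exp_le (by norm_num)]
  have h1 : Real.exp 1.945910 = Real.exp 1 * Real.exp 0.945910 := by rw [← Real.exp_add]; norm_num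
  have h2 : Real.exp 0.945910 ≤ 2.5751559 := by
    have h := Real.exp_bound' (x := (0.945910 : ℝ)) (by norm_num) (by norm_num) (n := 8) (by norm_num)
    refine h.trans ?_
    simp only [Finset.sum_range_succ, Finset.sum_range_zero, Nat.factorial]
    norm_num
  rw [h1]
  have := Real.exp_one_lt_d9
  nlinarith [Real.exp_pos 0.945910]

/-- `2.397895 ≤ log 11`. [folklore] -/
private theorem log_eleven_ge : (2.397895 : ℝ) ≤ Real.log 11 := by
  rw [Real.le_log_iff_exp_le (by norm_num)]
  have h1 : Real.exp 2.397895 = Real.exp 1 ^ 2 * Real.exp 0.397895 := by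
    rw [← Real.exp_nat_mul, ← Real.exp_add]; norm_num
  have h2 : Real.exp 0.397895 ≤ 1.4886878 := by
    have h := Real.exp_bound' (x := (0.397895 : ℝ)) (by norm_num) (by norm_num) (n := 7) (by norm_num)
    refine h.trans ?_
    simp only [Finset.sum_range_succ, Finset.sum_range_zero, Nat.factorial]
    norm_num
  rw [h1]
  have he := Real.exp_one_lt_d9
  have he0 := Real.exp_pos (1 : ℝ)
  have : Real.exp 1 ^ 2 ≤ 2.7182818286 ^ 2 := pow_le_pow_left₀ he0.le he.le 2
  nlinarith [Real.exp_pos (0.397895 : ℝ)]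

/-- `2.564949 ≤ log 13`. [folklore] -/
private theorem log_thirteen_ge' : (2.564949 : ℝ) ≤ Real.log 13 := by
  rw [Real.le_log_iff_exp_le (by norm_num)]
  have h1 : Real.exp 2.564949 = Real.exp 1 ^ 2 * Real.exp 0.564949 := by
    rw [← Real.exp_nat_mul, ← Real.exp_add]; norm_num
  have h2 : Real.exp 0.564949 ≤ 1.7593583 := by
    have h := Real.exp_bound' (x := (0.564949 : ℝ)) (by norm_num) (by norm_num) (n := 7) (by norm_num)
    refine h.trans ?_
    simp only [Finset.sum_range_succ, Finset.sum_range_zero, Nat.factorial]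
    norm_num
  rw [h1]
  have he := Real.exp_one_lt_d9
  have he0 := Real.exp_pos (1 : ℝ)
  have : Real.exp 1 ^ 2 ≤ 2.7182818286 ^ 2 := pow_le_pow_left₀ he0.le he.le 2
  nlinarith [Real.exp_pos (0.564949 : ℝ)]

/-! ### Values of `Λ` -/

/-- `Λ(2)`. [folklore] -/
private theorem vonMangoldt_two : (Λ 2 : ℝ) = Real.log 2 := by
  rw [vonMangoldt_apply_prime Nat.prime_two, Nat.cast_ofNat]
/-- `Λ(3)`. [folklore] -/
private theorem vonMangoldt_three : (Λ 3 : ℝ) = Real.log 3 := by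
  rw [vonMangoldt_apply_prime Nat.prime_three, Nat.cast_ofNat]
/-- `Λ(4 = 2²)`. [folklore] -/
private theorem vonMangoldt_four : (Λ 4 : ℝ) = Real.log 2 := by
  rw [show (4 : ℕ) = 2 ^ 2 by norm_num, vonMangoldt_apply_pow two_ne_zero, vonMangoldt_two]
/-- `Λ(5)`. [folklore] -/
private theorem vonMangoldt_five : (Λ 5 : ℝ) = Real.log 5 := by
  rw [vonMangoldt_apply_prime Nat.prime_five, Nat.cast_ofNat]
/-- `Λ(7)`. [folklore] -/
private theorem vonMangoldt_seven : (Λ 7 : ℝ) = Real.log 7 := by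
  rw [vonMangoldt_apply_prime (by norm_num), Nat.cast_ofNat]
/-- `Λ(8 = 2³)`. [folklore] -/
private theorem vonMangoldt_eight : (Λ 8 : ℝ) = Real.log 2 := by
  rw [show (8 : ℕ) = 2 ^ 3 by norm_num, vonMangoldt_apply_pow (by norm_num), vonMangoldt_two]
/-- `Λ(9 = 3²)`. [folklore] -/
private theorem vonMangoldt_nine : (Λ 9 : ℝ) = Real.log 3 := by
  rw [show (9 : ℕ) = 3 ^ 2 by norm_num, vonMangoldt_apply_pow two_ne_zero, vonMangoldt_three]
/-- `Λ(11)`. [folklore] -/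
private theorem vonMangoldt_eleven : (Λ 11 : ℝ) = Real.log 11 := by
  rw [vonMangoldt_apply_prime (by norm_num), Nat.cast_ofNat]
/-- `Λ(13)`. [folklore] -/
private theorem vonMangoldt_thirteen : (Λ 13 : ℝ) = Real.log 13 := by
  rw [vonMangoldt_apply_prime (by norm_num), Nat.cast_ofNat]
/-- `Λ(16 = 2⁴)`. [folklore] -/
private theorem vonMangoldt_sixteen : (Λ 16 : ℝ) = Real.log 2 := by
  rw [show (16 : ℕ) = 2 ^ 4 by norm_num, vonMangoldt_apply_pow (by norm_num), vonMangoldt_two]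

/-- The ten-term lower bound `Σ_{n ∈ {2,3,4,5,7,8,9,11,13,16}} Λ(n) n^{−2}(1 + y + y²/2) ≤ −ζ'/ζ(s)` with
`y = c·(lower bound for log n)`, for `1 < s ≤ 2 − c`, `c ≥ 0`. [cite: McCurley1984ZFR, Lemma 3 (proof, (12))] -/
private theorem neg_logDeriv_zeta_re_ge_of {s c : ℝ} (hs1 : 1 < s) (hs : s ≤ 2 - c) (hc : 0 ≤ c) :
    Real.log 2 / 4 * (1 + c * 0.693147 + (c * 0.693147) ^ 2 / 2)
      + Real.log 3 / 9 * (1 + c * 1.098612 + (c * 1.098612) ^ 2 / 2)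
      + Real.log 2 / 16 * (1 + c * (2 * 0.693147) + (c * (2 * 0.693147)) ^ 2 / 2)
      + Real.log 5 / 25 * (1 + c * 1.609437 + (c * 1.609437) ^ 2 / 2)
      + Real.log 7 / 49 * (1 + c * 1.945910 + (c * 1.945910) ^ 2 / 2)
      + Real.log 2 / 64 * (1 + c * (3 * 0.693147) + (c * (3 * 0.693147)) ^ 2 / 2)
      + Real.log 3 / 81 * (1 + c * (2 * 1.098612) + (c * (2 * 1.098612)) ^ 2 / 2)
      + Real.log 11 / 121 * (1 + c * 2.397895 + (c * 2.397895) ^ 2 / 2)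
      + Real.log 13 / 169 * (1 + c * 2.564949 + (c * 2.564949) ^ 2 / 2)
      + Real.log 2 / 256 * (1 + c * (4 * 0.693147) + (c * (4 * 0.693147)) ^ 2 / 2)
      ≤ (-(deriv riemannZeta s / riemannZeta s)).re := by
  have hS := sum_vonMangoldt_div_rpow_le hs1 {2, 3, 4, 5, 7, 8, 9, 11, 13, 16}
  rw [Finset.sum_insert (by decide), Finset.sum_insert (by decide), Finset.sum_insert (by decide),
    Finset.sum_insert (by decide), Finset.sum_insert (by decide), Finset.sum_insert (by decide),
    Finset.sum_insert (by decide), Finset.sum_insert (by decide), Finset.sum_insert (by decide),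
    Finset.sum_singleton] at hS
  have l2 := log_two_ge
  have l3 := log_three_ge
  have l5 := log_five_ge
  have l7 := log_seven_ge
  have l11 := log_eleven_ge
  have l13 := log_thirteen_ge'
  have t2 := vonMangoldt_div_rpow_ge (n := 2) (by norm_num) hs hc (L := 0.693147) (by norm_num)
    (by norm_num; linarith [l2])
  have t3 := vonMangoldt_div_rpow_ge (n := 3) (by norm_num) hs hc (L := 1.098612) (by norm_num)
    (by norm_num; linarith [l3])
  have t4 := vonMangoldt_div_rpow_ge (n := 4) (by norm_num) hs hc (L := 2 * 0.693147) (by norm_num)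
    (by rw [show ((4 : ℕ) : ℝ) = (2 : ℝ) ^ 2 by norm_num, Real.log_pow]; push_cast; linarith)
  have t5 := vonMangoldt_div_rpow_ge (n := 5) (by norm_num) hs hc (L := 1.609437) (by norm_num)
    (by norm_num; linarith [l5])
  have t7 := vonMangoldt_div_rpow_ge (n := 7) (by norm_num) hs hc (L := 1.945910) (by norm_num)
    (by norm_num; linarith [l7])
  have t8 := vonMangoldt_div_rpow_ge (n := 8) (by norm_num) hs hc (L := 3 * 0.693147) (by norm_num)
    (by rw [show ((8 : ℕ) : ℝ) = (2 : ℝ) ^ 3 by norm_num, Real.log_pow]; push_cast; linarith)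
  have t9 := vonMangoldt_div_rpow_ge (n := 9) (by norm_num) hs hc (L := 2 * 1.098612) (by norm_num)
    (by rw [show ((9 : ℕ) : ℝ) = (3 : ℝ) ^ 2 by norm_num, Real.log_pow]; push_cast; linarith)
  have t11 := vonMangoldt_div_rpow_ge (n := 11) (by norm_num) hs hc (L := 2.397895) (by norm_num)
    (by norm_num; linarith [l11])
  have t13 := vonMangoldt_div_rpow_ge (n := 13) (by norm_num) hs hc (L := 2.564949) (by norm_num)
    (by norm_num; linarith [l13])
  have t16 := vonMangoldt_div_rpow_ge (n := 16) (by norm_num) hs hc (L := 4 * 0.693147) (by norm_num)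
    (by rw [show ((16 : ℕ) : ℝ) = (2 : ℝ) ^ 4 by norm_num, Real.log_pow]; push_cast; linarith)
  rw [vonMangoldt_two, vonMangoldt_three, vonMangoldt_four, vonMangoldt_five, vonMangoldt_seven,
    vonMangoldt_eight, vonMangoldt_nine, vonMangoldt_eleven, vonMangoldt_thirteen, vonMangoldt_sixteen] at hS
  rw [vonMangoldt_two] at t2
  rw [vonMangoldt_three] at t3
  rw [vonMangoldt_four] at t4
  rw [vonMangoldt_five] at t5
  rw [vonMangoldt_seven] at t7
  rw [vonMangoldt_eight] at t8
  rw [vonMangoldt_nine] at t9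
  rw [vonMangoldt_eleven] at t11
  rw [vonMangoldt_thirteen] at t13
  rw [vonMangoldt_sixteen] at t16
  norm_num at t2 t3 t4 t5 t7 t8 t9 t11 t13 t16 hS ⊢
  linarith

/-- **`−ζ'/ζ(s) ≥ 0.5738` for `1 < s ≤ 1.9`** (prime powers `n ≤ 16`). [cite: McCurley1984ZFR, Lemma 3 (12)] -/
theorem neg_logDeriv_zeta_re_ge_19 {s : ℝ} (hs1 : 1 < s) (hs : s ≤ 1.9) :
    (0.5738 : ℝ) ≤ (-(deriv riemannZeta s / riemannZeta s)).re := by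
  have h := neg_logDeriv_zeta_re_ge_of (c := 0.1) hs1 (by norm_num; linarith) (by norm_num)
  have l2 := log_two_ge
  have l3 := log_three_ge
  have l5 := log_five_ge
  have l7 := log_seven_ge
  have l11 := log_eleven_ge
  have l13 := log_thirteen_ge'
  norm_num at h l2 l3 l5 l7 l11 l13 ⊢
  linarith

/-- **`−ζ'/ζ(s) ≥ 0.6869` for `1 < s ≤ 1.76`** (prime powers `n ≤ 16`). [cite: McCurley1984ZFR, Lemma 3 (12)] -/
theorem neg_logDeriv_zeta_re_ge_176 {s : ℝ} (hs1 : 1 < s) (hs : s ≤ 1.76) :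
    (0.6869 : ℝ) ≤ (-(deriv riemannZeta s / riemannZeta s)).re := by
  have h := neg_logDeriv_zeta_re_ge_of (c := 0.24) hs1 (by norm_num; linarith) (by norm_num)
  have l2 := log_two_ge
  have l3 := log_three_ge
  have l5 := log_five_ge
  have l7 := log_seven_ge
  have l11 := log_eleven_ge
  have l13 := log_thirteen_ge'
  norm_num at h l2 l3 l5 l7 l11 l13 ⊢
  linarith

/-! ## `σ₁` ranges and the sharpened Lemma 3 -/

/-- `σ₁ ≤ 1.9` for `0 ≤ σ ≤ 1.3` (`√(1+4σ²) ≤ 2.8`). [cite: McCurley1984ZFR, §2 (definition of σ₁)] -/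
theorem sigmaOne_le_19 {σ : ℝ} (hσ0 : 0 ≤ σ) (hσ : σ ≤ 1.3) : sigmaOne σ ≤ 1.9 := by
  unfold sigmaOne
  have h : Real.sqrt (1 + 4 * σ ^ 2) ≤ 2.8 := by
    rw [show (2.8 : ℝ) = Real.sqrt (2.8 ^ 2) by rw [Real.sqrt_sq (by norm_num)]]
    exact Real.sqrt_le_sqrt (by nlinarith)
  linarith

/-- `σ₁ ≤ 1.76` for `0 ≤ σ ≤ 1.15` (`√(1+4σ²) ≤ 2.52`). [cite: McCurley1984ZFR, §2 (definition of σ₁)] -/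
theorem sigmaOne_le_176 {σ : ℝ} (hσ0 : 0 ≤ σ) (hσ : σ ≤ 1.15) : sigmaOne σ ≤ 1.76 := by
  unfold sigmaOne
  have h : Real.sqrt (1 + 4 * σ ^ 2) ≤ 2.52 := by
    rw [show (2.52 : ℝ) = Real.sqrt (2.52 ^ 2) by rw [Real.sqrt_sq (by norm_num)]]
    exact Real.sqrt_le_sqrt (by nlinarith)
  linarith

/-- **McCurley's Lemma 3 (zeta term), `1 < σ ≤ 1.3`: `f_ζ(σ) ≤ 1/(σ−1) − 0.73`** [McCurley: `0.7833`].
[cite: McCurley1984ZFR, Lemma 3] -/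
theorem fdiffZeta_le_sharp13 {σ : ℝ} (hσ : 1 < σ) (hσ' : σ ≤ 1.3) :
    fdiffZeta σ ≤ 1 / (σ - 1) - 0.73 := by
  have h1 := neg_logDeriv_zeta_re_le_13 hσ hσ'
  have h2 := neg_logDeriv_zeta_re_ge_19 (one_lt_sigmaOne hσ.le) (sigmaOne_le_19 (by linarith) hσ')
  have h3 := mul_le_mul kappa_gt.le h2 (by norm_num) kappa_pos.le
  unfold fdiffZeta
  linarith

/-- **McCurley's Lemma 3 (zeta term), `1 < σ ≤ 1.15`: `f_ζ(σ) ≤ 1/(σ−1) − 0.80`** [McCurley: `0.8973`].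
[cite: McCurley1984ZFR, Lemma 3] -/
theorem fdiffZeta_le_sharp115 {σ : ℝ} (hσ : 1 < σ) (hσ' : σ ≤ 1.15) :
    fdiffZeta σ ≤ 1 / (σ - 1) - 0.80 := by
  have h1 := neg_logDeriv_zeta_re_le_115 hσ hσ'
  have h2 := neg_logDeriv_zeta_re_ge_176 (one_lt_sigmaOne hσ.le) (sigmaOne_le_176 (by linarith) hσ')
  have h3 := mul_le_mul kappa_gt.le h2 (by norm_num) kappa_pos.le
  unfold fdiffZeta
  linarith

/-- **McCurley's Lemma 3 for the principal character mod `k`, `1 < σ ≤ 1.3`:**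
`f(0, χ₀ mod k) ≤ 1/(σ−1) − 0.73 − s_k(σ)`, `s_k(σ) = Σ_{p∣k}[U(p,σ) − κU(p,σ₁)]` (McCurley's `s(k)`,
kept exactly). [cite: McCurley1984ZFR, Lemma 3] -/
theorem fdiff_principal_le_sharp13 {k : ℕ} [NeZero k] {σ : ℝ} (hσ : 1 < σ) (hσ' : σ ≤ 1.3) :
    fdiff (1 : DirichletCharacter ℂ k) σ ≤
      1 / (σ - 1) - 0.73 - ∑ p ∈ k.primeFactors, (uCorr p σ - kappa * uCorr p (sigmaOne σ)) := by
  rw [fdiff_principal_eq hσ]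
  linarith [fdiffZeta_le_sharp13 hσ hσ']

/-- **McCurley's Lemma 3 for the principal character mod `k`, `1 < σ ≤ 1.15`:**
`f(0, χ₀ mod k) ≤ 1/(σ−1) − 0.80 − s_k(σ)`. [cite: McCurley1984ZFR, Lemma 3] -/
theorem fdiff_principal_le_sharp115 {k : ℕ} [NeZero k] {σ : ℝ} (hσ : 1 < σ) (hσ' : σ ≤ 1.15) :
    fdiff (1 : DirichletCharacter ℂ k) σ ≤
      1 / (σ - 1) - 0.80 - ∑ p ∈ k.primeFactors, (uCorr p σ - kappa * uCorr p (sigmaOne σ)) := by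
  rw [fdiff_principal_eq hσ]
  linarith [fdiffZeta_le_sharp115 hσ hσ']

end McCurleyStechkin

end Literature.NumberTheory.LFunctions
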